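import Summits.CriticalPhenomena.PercolationContinuityZ3.Theorems.PercNearOneGluingAdditiveGluingOneBond
import HarnessLib

/-!
# `NoHeavyLowerTail` (stmt-CriticalPhenomena-4575) — hull-port line: scenario disintegration over a set of pairs

Support file (prover `prim-hp-1`; `--supports stmt-CriticalPhenomena-4575`); no definitions, named facts or sorries.

For a finite set `E` of pairs, every probability under `μ_w = prodBernoulli w` is the mixture, over the subsets `T ⊆ E` of open
pairs, of the probabilities under the SCENARIO weights `w_{E,T}` (pairs of `T` set to `1`, pairs of `E ∖ T` set to `0`), with the
product-law coefficients `∏_{e∈T} w e · ∏_{e∈E∖T} (1 − w e)`: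
`HullPort.real_eq_sum_scenarios` (iterated one-bond decomposition `stub_oneBondDecomp_k15`).  With `E` = the coins of one or two
relay-neighboured phantoms this is the disintegration used throughout the crux memo (HULLPORT-COUPLING.md §4–§19) to pass from
scenario-level statements (`selection_pair_core`, `threeCluster_scenario_of_LSL`, …) to weight-level ones. [folklore]
-/

noncomputable section

namespace Summit.CriticalPhenomena.PercolationContinuityZ3.Theorems

open MeasureTheory Set Literature.Probability.LatticeModels Literature.Probability.Percolation
open scoped Classical BigOperators

variable {n : ℕ}

namespace HullPort

/-- **Scenario disintegration.**  For every finite set `E` of pairs, weights `w` and event `S`: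
`μ_w(S) = ∑_{T ⊆ E} (∏_{e∈T} w e)(∏_{e∈E∖T} (1 − w e)) · μ_{w_{E,T}}(S)`, where `w_{E,T} e = 1` for `e ∈ T`, `= 0` for
`e ∈ E ∖ T`, `= w e` otherwise. [folklore] -/
theorem real_eq_sum_scenarios (E : Finset (Sym2 (Fin n))) :
    ∀ (w : Sym2 (Fin n) → unitInterval) (S : Set (BondConfig (Fin n))),
      (prodBernoulli w).real S =
        ∑ T ∈ E.powerset, ((∏ e ∈ T, (w e : ℝ)) * ∏ e ∈ E \ T, (1 - (w e : ℝ))) *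
          (prodBernoulli (fun e => if e ∈ T then 1 else if e ∈ E then 0 else w e)).real S := by
  induction E using Finset.induction_on with
  | empty =>
    intro w S
    simp only [Finset.powerset_empty, Finset.sum_singleton, Finset.prod_empty, Finset.sdiff_self,
      Finset.notMem_empty, if_false, one_mul]
  | @insert a E haE ih =>
    intro w S
    rw [Finset.sum_powerset_insert haE]
    -- one-bond decomposition at `a`, then the induction hypothesis for both branches
    rw [stub_oneBondDecomp_k15 n w a S, ih (Function.update w a 0) S, ih (Function.update w a 1) S,
      Finset.mul_sum, Finset.mul_sum]
    congr 1
    · refine Finset.sum_congr rfl fun T hT => ?_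
      have hTE : T ⊆ E := Finset.mem_powerset.1 hT
      have haT : a ∉ T := fun h => haE (hTE h)
      have hw0 : ∀ e ∈ T, (Function.update w a 0 e : ℝ) = w e := fun e he => by
        rw [Function.update_of_ne (show e ≠ a from fun h => haT (h ▸ he))]
      have hw0' : ∀ e ∈ E \ T, (1 - (Function.update w a 0 e : ℝ)) = 1 - w e := fun e he => by
        rw [Function.update_of_ne (show e ≠ a from fun h => haE (h ▸ (Finset.mem_sdiff.1 he).1))]
      have hglue : (fun e => if e ∈ T then (1 : unitInterval) else if e ∈ E then 0 else Function.update w a 0 e) =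
          (fun e => if e ∈ T then 1 else if e ∈ insert a E then 0 else w e) := by
        funext e
        by_cases heT : e ∈ T
        · simp only [heT, if_true]
        · by_cases hea : e = a
          · subst hea
            simp only [heT, if_false, haE, Finset.mem_insert, true_or, if_true, Function.update_self]
          · simp only [heT, if_false, Finset.mem_insert, hea, false_or, Function.update_of_ne hea]
      have hsd : insert a E \ T = insert a (E \ T) := by
        ext e
        simp only [Finset.mem_sdiff, Finset.mem_insert]
        constructor
        · rintro ⟨h1 | h1, h2⟩
          · exact Or.inl h1
          · exact Or.inr ⟨h1, h2⟩
        · rintro (h1 | ⟨h1, h2⟩)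
          · exact ⟨Or.inl h1, h1 ▸ haT⟩
          · exact ⟨Or.inr h1, h2⟩
      have haET : a ∉ E \ T := fun h => haE (Finset.mem_sdiff.1 h).1
      rw [Finset.prod_congr rfl hw0, Finset.prod_congr rfl hw0', hglue, hsd, Finset.prod_insert haET]
      ring
    · refine Finset.sum_congr rfl fun T hT => ?_
      have hTE : T ⊆ E := Finset.mem_powerset.1 hT
      have haT : a ∉ T := fun h => haE (hTE h)
      have hw1 : ∀ e ∈ T, (Function.update w a 1 e : ℝ) = w e := fun e he => by
        rw [Function.update_of_ne (show e ≠ a from fun h => haT (h ▸ he))]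
      have hw1' : ∀ e ∈ E \ T, (1 - (Function.update w a 1 e : ℝ)) = 1 - w e := fun e he => by
        rw [Function.update_of_ne (show e ≠ a from fun h => haE (h ▸ (Finset.mem_sdiff.1 he).1))]
      have hglue : (fun e => if e ∈ T then (1 : unitInterval) else if e ∈ E then 0 else Function.update w a 1 e) =
          (fun e => if e ∈ insert a T then 1 else if e ∈ insert a E then 0 else w e) := by
        funext e
        by_cases heT : e ∈ T
        · simp only [heT, if_true, Finset.mem_insert, or_true]
        · by_cases hea : e = a
          · subst hea
            simp only [heT, if_false, haE, Finset.mem_insert, true_or, if_true, Function.update_self]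
          · simp only [heT, if_false, Finset.mem_insert, hea, false_or, Function.update_of_ne hea]
      have hsd : insert a E \ insert a T = E \ T := by
        ext e
        simp only [Finset.mem_sdiff, Finset.mem_insert, not_or]
        constructor
        · rintro ⟨h1 | h1, h2, h3⟩
          · exact absurd h1 h2
          · exact ⟨h1, h3⟩
        · rintro ⟨h1, h3⟩
          exact ⟨Or.inr h1, fun h => haE (h ▸ h1), h3⟩
      rw [Finset.prod_congr rfl hw1, Finset.prod_congr rfl hw1', hglue, hsd, Finset.prod_insert haT]
      ring

end HullPort

end Summit.CriticalPhenomena.PercolationContinuityZ3.Theorems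

end
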